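import Summits.Ventures.PercRepro.C026PFunUnion

/-!
# The clusters and products of a vertex-disjoint union (p6, gen 16)

For vertex-disjoint `F₀`, `F₁` and configurations `ω₀ ⊆ F₀`, `ω₁ ⊆ F₁`, the clusters of `ω₀ ⊔ ω₁`
are the clusters of `ω₀` at the vertices not touched by `F₁` together with the clusters of `ω₁` at
the vertices touched by `F₁` (`clusters_join`); the clusters of `ω₀` alone are the former plus the
singletons of the vertices touched by `F₁` (`clusters_left`), and symmetrically.  Hence, with
`ρ = ∏_v (2 − x_v)`: `ρ·n̄(ω₀ ⊔ ω₁) = n̄(ω₀)·n̄(ω₁)` (`nbar_join`) and, for a probe `c` not touched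
by `F₁`, `ρ·N_c(ω₀ ⊔ ω₁) = N_c(ω₀)·n̄(ω₁)` (`nbarOff_join`), `X_c`, `K_c` of the join being those of `ω₀`.
-/

namespace PercRepro

namespace MultiGraph

open Finset

variable {V E : Type*} [Fintype V] [DecidableEq V] [Fintype E] [DecidableEq E] {G : MultiGraph V E}

variable (G) in
open Classical in
/-- The vertices touched by the edge set `F`. -/
noncomputable def touched (F : Finset E) : Finset V := univ.filter (G.Touches F)

omit [DecidableEq V] [Fintype E] [DecidableEq E] in
/-- Membership in `touched`. -/
theorem mem_touched {F : Finset E} {v : V} : v ∈ G.touched F ↔ G.Touches F v := by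
  unfold touched
  simp

omit [Fintype E] [DecidableEq E] in
/-- Membership in the complement of `touched`. -/
theorem mem_touched_compl {F : Finset E} {v : V} : v ∈ (G.touched F)ᶜ ↔ ¬ G.Touches F v := by
  rw [Finset.mem_compl, mem_touched]

omit [Fintype E] [DecidableEq E] in
/-- The vertices split into those not touched and those touched by `F`. -/
theorem compl_touched_union (F : Finset E) : (G.touched F)ᶜ ∪ G.touched F = univ := by
  ext v
  simp only [Finset.mem_union, Finset.mem_compl, Finset.mem_univ, iff_true]
  exact (em _).symm

/-- `ρ = ∏_v (2 − x_v)`: the product over all vertices of the isolated factor. -/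
noncomputable def rhoAll (x : V → ℝ) : ℝ := ∏ v, (2 - x v)

omit [DecidableEq V] [Fintype E] [DecidableEq E] in
/-- `ρ ≥ 1` for cells in `[0, 1]`. -/
theorem one_le_rhoAll {x : V → ℝ} (hx : ∀ v, 0 ≤ x v ∧ x v ≤ 1) : 1 ≤ rhoAll x :=
  Finset.one_le_prod fun v _ => by linarith [(hx v).1, (hx v).2]

section Clusters

variable {F₀ F₁ : Finset E} (hd : G.VDisjoint F₀ F₁) {ω₀ ω₁ : Config E} (h₀ : ω₀ ∈ configsIn F₀)
  (h₁ : ω₁ ∈ configsIn F₁)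
include hd h₀ h₁

omit h₁ in
/-- A cluster of `ω₀` at a vertex not touched by `F₁` avoids the vertices touched by `F₁`. -/
theorem clusterF_left_subset {v : V} (hv : v ∈ (G.touched F₁)ᶜ) :
    G.clusterF ω₀ v ⊆ (G.touched F₁)ᶜ := by
  intro w hw
  rw [mem_touched_compl]
  intro hw'
  have hiso : G.clusterF ω₀ w = {w} :=
    clusterF_eq_singleton_of_not_touches h₀ (fun ht => hd w ht hw')
  have hvw : v ∈ G.clusterF ω₀ w := by
    rw [← clusterF_eq_of_conn (mem_clusterF.1 hw)]
    exact self_mem_clusterF ω₀ v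
  rw [hiso, Finset.mem_singleton] at hvw
  exact (mem_touched_compl.1 hv) (hvw ▸ hw')

omit [DecidableEq V] hd h₀ in
/-- A cluster of `ω₁` at a vertex touched by `F₁` stays among the vertices touched by `F₁`. -/
theorem clusterF_right_subset {v : V} (hv : v ∈ G.touched F₁) :
    G.clusterF ω₁ v ⊆ G.touched F₁ := by
  intro w hw
  rw [mem_touched]
  by_contra hw'
  have hiso : G.clusterF ω₁ w = {w} := clusterF_eq_singleton_of_not_touches h₁ hw'
  have hvw : v ∈ G.clusterF ω₁ w := by
    rw [← clusterF_eq_of_conn (mem_clusterF.1 hw)]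
    exact self_mem_clusterF ω₁ v
  rw [hiso, Finset.mem_singleton] at hvw
  exact hw' (hvw ▸ mem_touched.1 hv)

/-- **The clusters of a join**: the `ω₀`-clusters off `F₁` and the `ω₁`-clusters on `F₁`. -/
theorem clusters_join :
    G.clusters (join ω₀ ω₁) =
      (G.touched F₁)ᶜ.image (G.clusterF ω₀) ∪ (G.touched F₁).image (G.clusterF ω₁) := by
  unfold clusters
  rw [← compl_touched_union (G := G) F₁, Finset.image_union]
  congr 1
  · refine Finset.image_congr fun v hv => ?_
    exact clusterF_join_left hd h₀ h₁ (mem_touched_compl.1 hv)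
  · refine Finset.image_congr fun v hv => ?_
    exact clusterF_join_right hd h₀ h₁ fun ht => hd v ht (mem_touched.1 hv)

omit h₁ in
/-- The clusters of `ω₀`: its clusters off `F₁` and the singletons on `F₁`. -/
theorem clusters_left :
    G.clusters ω₀ =
      (G.touched F₁)ᶜ.image (G.clusterF ω₀) ∪ (G.touched F₁).image (fun v => ({v} : Finset V)) := by
  unfold clusters
  rw [← compl_touched_union (G := G) F₁, Finset.image_union]
  congr 1
  refine Finset.image_congr fun v hv => ?_
  exact clusterF_eq_singleton_of_not_touches h₀ fun ht => hd v ht (mem_touched.1 hv)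

omit hd h₀ in
/-- The clusters of `ω₁`: the singletons off `F₁` and its clusters on `F₁`. -/
theorem clusters_right :
    G.clusters ω₁ =
      (G.touched F₁)ᶜ.image (fun v => ({v} : Finset V)) ∪ (G.touched F₁).image (G.clusterF ω₁) := by
  unfold clusters
  rw [← compl_touched_union (G := G) F₁, Finset.image_union]
  congr 1
  refine Finset.image_congr fun v hv => ?_
  exact clusterF_eq_singleton_of_not_touches h₁ (mem_touched_compl.1 hv)

omit h₁ in
/-- The two families of clusters are disjoint. -/
theorem disjoint_image_left_right :
    Disjoint ((G.touched F₁)ᶜ.image (G.clusterF ω₀)) ((G.touched F₁).image (G.clusterF ω₁)) := by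
  rw [Finset.disjoint_left]
  intro R hR hR'
  obtain ⟨v, hv, rfl⟩ := Finset.mem_image.1 hR
  obtain ⟨w, hw, hvw⟩ := Finset.mem_image.1 hR'
  have : w ∈ G.clusterF ω₀ v := hvw ▸ self_mem_clusterF ω₁ w
  exact mem_touched_compl.1 (clusterF_left_subset hd h₀ hv this) (mem_touched.1 hw)

omit h₁ in
/-- The `ω₀`-clusters off `F₁` are disjoint from the singletons on `F₁`. -/
theorem disjoint_image_left_singleton :
    Disjoint ((G.touched F₁)ᶜ.image (G.clusterF ω₀))
      ((G.touched F₁).image (fun v => ({v} : Finset V))) := by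
  rw [Finset.disjoint_left]
  intro R hR hR'
  obtain ⟨v, hv, rfl⟩ := Finset.mem_image.1 hR
  obtain ⟨w, hw, hvw⟩ := Finset.mem_image.1 hR'
  have : w ∈ G.clusterF ω₀ v := hvw ▸ Finset.mem_singleton_self w
  exact mem_touched_compl.1 (clusterF_left_subset hd h₀ hv this) (mem_touched.1 hw)

omit [Fintype E] [DecidableEq E] hd h₀ h₁ in
/-- The singletons off `F₁` are disjoint from the `ω₁`-clusters on `F₁`. -/
theorem disjoint_image_singleton_right :
    Disjoint ((G.touched F₁)ᶜ.image (fun v => ({v} : Finset V)))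
      ((G.touched F₁).image (G.clusterF ω₁)) := by
  rw [Finset.disjoint_left]
  intro R hR hR'
  obtain ⟨v, hv, rfl⟩ := Finset.mem_image.1 hR
  obtain ⟨w, hw, hvw⟩ := Finset.mem_image.1 hR'
  have : w ∈ ({v} : Finset V) := hvw ▸ self_mem_clusterF ω₁ w
  rw [Finset.mem_singleton] at this
  exact mem_touched_compl.1 hv (this ▸ mem_touched.1 hw)

end Clusters

section Products

omit [Fintype V] [Fintype E] [DecidableEq E] in
/-- The product of `2 − X_R` over singletons. -/
theorem prod_image_singleton (x : V → ℝ) (S : Finset V) :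
    ∏ R ∈ S.image (fun v => ({v} : Finset V)), (2 - ∏ v ∈ R, x v) = ∏ v ∈ S, (2 - x v) := by
  rw [Finset.prod_image]
  · simp only [Finset.prod_singleton]
  · intro v _ w _ h
    exact Finset.singleton_inj.1 h

variable {F₀ F₁ : Finset E} (hd : G.VDisjoint F₀ F₁) {ω₀ ω₁ : Config E} (h₀ : ω₀ ∈ configsIn F₀)
  (h₁ : ω₁ ∈ configsIn F₁) (x : V → ℝ)
include hd h₀ h₁

/-- **`ρ·n̄(ω₀ ⊔ ω₁) = n̄(ω₀)·n̄(ω₁)`.** -/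
theorem nbar_join : rhoAll x * G.nbar x (join ω₀ ω₁) = G.nbar x ω₀ * G.nbar x ω₁ := by
  unfold nbar rhoAll
  rw [clusters_join hd h₀ h₁, clusters_left hd h₀ (F₁ := F₁), clusters_right h₁,
    Finset.prod_union (disjoint_image_left_right hd h₀),
    Finset.prod_union (disjoint_image_left_singleton hd h₀),
    Finset.prod_union (disjoint_image_singleton_right (G := G) (ω₁ := ω₁) (F₁ := F₁)),
    prod_image_singleton, prod_image_singleton,
    ← Finset.prod_mul_prod_compl (G.touched F₁) (fun v => (2 - x v))]
  ring

/-- **`ρ·N_c(ω₀ ⊔ ω₁) = N_c(ω₀)·n̄(ω₁)`** for a probe `c` not touched by `F₁`. -/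
theorem nbarOff_join {c : V} (hc : ¬ G.Touches F₁ c) :
    rhoAll x * G.nbarOff x c (join ω₀ ω₁) = G.nbarOff x c ω₀ * G.nbar x ω₁ := by
  have hcl : G.clusterF (join ω₀ ω₁) c = G.clusterF ω₀ c := clusterF_join_left hd h₀ h₁ hc
  have hmem : G.clusterF ω₀ c ∈ (G.touched F₁)ᶜ.image (G.clusterF ω₀) :=
    Finset.mem_image_of_mem _ (mem_touched_compl.2 hc)
  have hnot1 : G.clusterF ω₀ c ∉ (G.touched F₁).image (G.clusterF ω₁) :=
    Finset.disjoint_left.1 (disjoint_image_left_right hd h₀) hmem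
  have hnot2 : G.clusterF ω₀ c ∉ (G.touched F₁).image (fun v => ({v} : Finset V)) :=
    Finset.disjoint_left.1 (disjoint_image_left_singleton hd h₀) hmem
  unfold nbarOff nbar rhoAll
  rw [hcl, clusters_join hd h₀ h₁, clusters_left hd h₀ (F₁ := F₁), clusters_right h₁,
    Finset.erase_union_distrib, Finset.erase_eq_of_notMem hnot1, Finset.erase_union_distrib,
    Finset.erase_eq_of_notMem hnot2,
    Finset.prod_union (Finset.disjoint_of_subset_left (Finset.erase_subset _ _)
      (disjoint_image_left_right hd h₀)),
    Finset.prod_union (Finset.disjoint_of_subset_left (Finset.erase_subset _ _)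
      (disjoint_image_left_singleton hd h₀)),
    Finset.prod_union (disjoint_image_singleton_right (G := G) (ω₁ := ω₁) (F₁ := F₁)),
    prod_image_singleton, prod_image_singleton,
    ← Finset.prod_mul_prod_compl (G.touched F₁) (fun v => (2 - x v))]
  ring

end Products

end MultiGraph

end PercRepro
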